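import Summits.Ventures.YMGap.Thresholds.SharpClusteringSobolev
import HarnessLib

/-!
# Venture YMGap — static exponential clustering, Part II-b:
# weak gradients on `H¹(σ^{⊗E})`, and smooth functions belong to `H¹`

HONEST FRAMING: venture file (cell `pub-ymgap`, track (a), seat lit-1); continuation of
`SharpClusteringSobolev`. No physics and no number in this file.

* `HOne_le_weakGrad` — every `z = (ψ, ζ) ∈ H¹` has `ζ` as WEAK GRADIENT of `ψ`:
  `⟪ζ_a, s⟫ = -⟪ψ, D_a s⟫` for smooth `s` (integration by parts on `J(𝒫)`, closedness), whence
  `∫ Δs · ψ = -∑_a ∫ D_a s · ζ_a` (`integral_Lap_mul_fst`);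
* `sobJ_mem_HOne` — smooth functions belong to `H¹`: `J(p_n) → J(F)` for the `L²`-projections
  `p_n` of `F` onto `𝒫_n`, because `Δ𝒫_n ⊆ 𝒫_n` makes `∫ Γ(p_n - F) = ∫ (p_n - F) ΔF → 0` — the
  `Δ`-invariance of the polynomial filtration replaces the `C¹` Weierstrass theorem.

## References

* Venture files `LatticeBakryEmery{Polynomials,Integration,L2}.lean` (seat p2), `SharpClusteringSobolev`.
-/

noncomputable section

open scoped Matrix ComplexConjugate BigOperators Matrix.Norms.Frobenius ContDiff Topology InnerProductSpace
open Matrix Complex Finset MeasureTheory Filter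
open Literature.MathematicalPhysics.QuantumFieldTheory

namespace Summit.Ventures.YMGap

namespace SharpClustering

open LatticeBakryEmery

universe u

variable {ι : Type u} [Fintype ι] [DecidableEq ι] {N : ℕ}

/-! ### The weak-gradient identity on `H¹` -/

/-- **Integration by parts for frame derivatives**: `∫ D_aF · G dσ^{⊗E} = -∫ F · D_aG dσ^{⊗E}`. -/
theorem integral_algD_mul (hN : N ≠ 0) {F G : Cfg ι N → ℝ} (hF : ContDiff ℝ ∞ F) (hG : ContDiff ℝ ∞ G)
    (a : BIdx ι N) :
    ∫ g : PSU ι N, algD (bframe a) F (emb g) * G (emb g) ∂(haarPi ι N) =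
      -∫ g : PSU ι N, F (emb g) * algD (bframe a) G (emb g) ∂(haarPi ι N) := by
  have h := integral_algD_bframe_eq_zero hN (hF.mul hG) a
  rw [algD_fun_mul hF hG] at h
  simp only at h
  have i1 : Integrable (fun g : PSU ι N => F (emb g) * algD (bframe a) G (emb g)) (haarPi ι N) :=
    integrable_of_continuous_PSU ((continuous_restrict hF).mul (continuous_restrict (contDiff_algD hG _))) _
  have i2 : Integrable (fun g : PSU ι N => G (emb g) * algD (bframe a) F (emb g)) (haarPi ι N) :=
    integrable_of_continuous_PSU ((continuous_restrict hG).mul (continuous_restrict (contDiff_algD hF _))) _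
  rw [integral_add i1 i2] at h
  have e : ∫ g : PSU ι N, algD (bframe a) F (emb g) * G (emb g) ∂(haarPi ι N) =
      ∫ g : PSU ι N, G (emb g) * algD (bframe a) F (emb g) ∂(haarPi ι N) :=
    integral_congr_ae (ae_of_all _ fun g => mul_comm _ _)
  rw [e]
  linarith

variable (ι N) in
/-- The elements `z = (ψ, ζ)` of `𝓗` whose second component is the WEAK GRADIENT of the first:
`⟪ζ_a, s⟫ = -⟪ψ, D_a s⟫` for every smooth ambient `s` and every frame index `a`. -/
def weakGrad : Submodule ℝ (HSp ι N) where
  carrier := {z | ∀ (a : BIdx ι N) (s : Cfg ι N → ℝ) (hs : ContDiff ℝ ∞ s),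
    ⟪z.snd a, sL2 s hs⟫_ℝ = -⟪z.fst, sL2 (algD (bframe a) s) (contDiff_algD hs _)⟫_ℝ}
  add_mem' {z z'} hz hz' := by
    intro a s hs
    rw [WithLp.add_snd, WithLp.add_fst]
    change ⟪z.snd a + z'.snd a, _⟫_ℝ = _
    rw [inner_add_left, inner_add_left, hz a s hs, hz' a s hs]
    ring
  zero_mem' := by
    intro a s hs
    rw [WithLp.zero_snd, WithLp.zero_fst]
    change ⟪(0 : Lp ℝ 2 (haarPi ι N)), _⟫_ℝ = _
    rw [inner_zero_left, inner_zero_left, neg_zero]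
  smul_mem' r z hz := by
    intro a s hs
    rw [WithLp.smul_snd, WithLp.smul_fst]
    change ⟪r • z.snd a, _⟫_ℝ = _
    rw [real_inner_smul_left, real_inner_smul_left, hz a s hs]
    ring

omit [DecidableEq ι] in
/-- The component maps of `𝓗` are continuous. -/
theorem continuous_HSp_fst : Continuous fun z : HSp ι N => z.fst :=
  WithLp.continuous_fst _ _ _

omit [DecidableEq ι] in
/-- The gradient components depend continuously on `z ∈ 𝓗`. -/
theorem continuous_HSp_snd_apply (a : BIdx ι N) : Continuous fun z : HSp ι N => z.snd a :=
  (PiLp.continuous_apply 2 _ a).comp (WithLp.continuous_snd _ _ _)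

/-- The weak-gradient subspace is closed. -/
theorem isClosed_weakGrad : IsClosed (weakGrad ι N : Set (HSp ι N)) := by
  have : (weakGrad ι N : Set (HSp ι N)) = ⋂ (a : BIdx ι N), ⋂ (s : Cfg ι N → ℝ), ⋂ (hs : ContDiff ℝ ∞ s),
      {z : HSp ι N | ⟪z.snd a, sL2 s hs⟫_ℝ = -⟪z.fst, sL2 (algD (bframe a) s) (contDiff_algD hs _)⟫_ℝ} := by
    ext z
    simp only [Set.mem_iInter, Set.mem_setOf_eq]
    rfl
  rw [this]
  refine isClosed_iInter fun a => isClosed_iInter fun s => isClosed_iInter fun hs => ?_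
  exact isClosed_eq ((continuous_HSp_snd_apply a).inner continuous_const)
    ((continuous_HSp_fst.inner continuous_const).neg)

/-- `J(𝒫_n)` satisfies the weak-gradient identity (integration by parts). -/
theorem VSob_le_weakGrad (hN : N ≠ 0) (n : ℕ) : VSob ι N n ≤ weakGrad ι N := by
  rintro _ ⟨p, rfl⟩
  intro a s hs
  rw [sobPoly_apply, sobJ_snd_apply, sobJ_fst, inner_sL2_sL2, inner_sL2_sL2]
  exact integral_algD_mul hN (contDiff_of_mem_polySpace p.2) hs a

/-- **`H¹ ≤ weakGrad`**: on `H¹` the second component is the weak gradient of the first. -/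
theorem HOne_le_weakGrad (hN : N ≠ 0) : HOne ι N ≤ weakGrad ι N :=
  Submodule.topologicalClosure_minimal _ (iSup_le fun n => VSob_le_weakGrad hN n) isClosed_weakGrad

/-- The weak-gradient identity, unpacked: for `z ∈ H¹`, smooth `s` and a frame index `a`,
`∫ s ζ_a dσ^{⊗E} = -∫ D_a s · ψ dσ^{⊗E}`. -/
theorem integral_snd_mul_eq (hN : N ≠ 0) {z : HSp ι N} (hz : z ∈ HOne ι N) (a : BIdx ι N)
    {s : Cfg ι N → ℝ} (hs : ContDiff ℝ ∞ s) :
    ∫ g : PSU ι N, s (emb g) * z.snd a g ∂(haarPi ι N) =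
      -∫ g : PSU ι N, algD (bframe a) s (emb g) * z.fst g ∂(haarPi ι N) := by
  have h := HOne_le_weakGrad hN hz a s hs
  rw [real_inner_comm, inner_sL2_left, real_inner_comm, inner_sL2_left] at h
  exact h

/-- For `z = (ψ, ζ) ∈ H¹` and smooth `s`: `∫ Δs · ψ = -∑_a ∫ D_a s · ζ_a` ("`⟨ψ, Δs⟩ = -⟨ζ, ∇s⟩`"). -/
theorem integral_Lap_mul_fst (hN : N ≠ 0) {z : HSp ι N} (hz : z ∈ HOne ι N) {s : Cfg ι N → ℝ}
    (hs : ContDiff ℝ ∞ s) :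
    ∫ g : PSU ι N, Lap s (emb g) * z.fst g ∂(haarPi ι N) =
      -∑ a, ∫ g : PSU ι N, algD (bframe a) s (emb g) * z.snd a g ∂(haarPi ι N) := by
  have h : ∀ a : BIdx ι N, ∫ g : PSU ι N, algD (bframe a) s (emb g) * z.snd a g ∂(haarPi ι N) =
      -∫ g : PSU ι N, algD (bframe a) (algD (bframe a) s) (emb g) * z.fst g ∂(haarPi ι N) :=
    fun a => integral_snd_mul_eq hN hz a (contDiff_algD hs _)
  simp_rw [h, sum_neg_distrib, neg_neg]
  rw [← integral_finsetSum _ fun a _ => integrable_continuous_mul_L2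
    (continuous_restrict (contDiff_algD (contDiff_algD hs _) _)) _]
  refine integral_congr_ae (ae_of_all _ fun g => ?_)
  simp only [Lap, sum_mul]

/-! ### Smooth functions belong to `H¹` -/

/-- `Δ(p - F) = Δp - ΔF` evaluated. -/
theorem Lap_sub_apply {F G : Cfg ι N → ℝ} (hF : ContDiff ℝ ∞ F) (hG : ContDiff ℝ ∞ G) (Q : Cfg ι N) :
    Lap (F - G) Q = Lap F Q - Lap G Q := by
  simp only [Lap, ← Finset.sum_sub_distrib]
  refine sum_congr rfl fun a _ => ?_
  rw [algD_sub hF hG, algD_sub (contDiff_algD hF _) (contDiff_algD hG _), Pi.sub_apply]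

/-- **Smooth functions are in `H¹`**: the `L²`-projections `p_n` of a smooth `F` onto the polynomial
subspaces satisfy `J(p_n) → J(F)` in `𝓗`, because `Δ𝒫_n ⊆ 𝒫_n` gives
`∫ Γ(p_n - F, p_n - F) = ∫ (p_n - F) ΔF ≤ ‖p_n - F‖ ‖ΔF‖`. -/
theorem sobJ_mem_HOne (hN : N ≠ 0) {F : Cfg ι N → ℝ} (hF : ContDiff ℝ ∞ F) : sobJ F hF ∈ HOne ι N := by
  set x : Lp ℝ 2 (haarPi ι N) := sL2 F hF with hx
  set xn : ℕ → Lp ℝ 2 (haarPi ι N) := fun n => (VPoly ι N n).starProjection x with hxn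
  have hxn_mem : ∀ n, xn n ∈ VPoly ι N n := fun n => by
    rw [hxn]; simp only [Submodule.starProjection_apply]; exact Submodule.coe_mem _
  have hq : ∀ n, ∃ q : polySpace ι N n, TPoly n q = xn n := fun n => LinearMap.mem_range.1 (hxn_mem n)
  choose q hq using hq
  have hqc : ∀ n, ContDiff ℝ ∞ (q n).1 := fun n => contDiff_of_mem_polySpace (q n).2
  have hqx : ∀ n, sL2 (q n).1 (hqc n) = xn n := fun n => by rw [← hq n, TPoly_apply]; rfl
  -- `xn → x`
  have ht : Tendsto (fun n => xn n) atTop (𝓝 x) :=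
    Submodule.starProjection_tendsto_self (VPoly ι N) monotone_VPoly x top_le_closure_iSup_VPoly
  have ht0 : Tendsto (fun n => ‖xn n - x‖) atTop (𝓝 0) := tendsto_iff_norm_sub_tendsto_zero.1 ht
  -- the Dirichlet energy of `q_n - F`
  have hE : ∀ n, ∫ g : PSU ι N, Gam ((q n).1 - F) ((q n).1 - F) (emb g) ∂(haarPi ι N) ≤
      ‖xn n - x‖ * ‖sL2 (Lap F) (contDiff_Lap hF)‖ := by
    intro n
    have hd : ContDiff ℝ ∞ ((q n).1 - F) := (hqc n).sub hF
    have h1 : ∫ g : PSU ι N, Gam ((q n).1 - F) ((q n).1 - F) (emb g) ∂(haarPi ι N) =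
        -∫ g : PSU ι N, ((q n).1 - F) (emb g) * Lap ((q n).1 - F) (emb g) ∂(haarPi ι N) := by
      rw [integral_mul_Lap hN hd hd]; ring
    have h2 : ∫ g : PSU ι N, ((q n).1 - F) (emb g) * Lap ((q n).1 - F) (emb g) ∂(haarPi ι N) =
        ∫ g : PSU ι N, ((q n).1 - F) (emb g) * Lap (q n).1 (emb g) ∂(haarPi ι N) -
          ∫ g : PSU ι N, ((q n).1 - F) (emb g) * Lap F (emb g) ∂(haarPi ι N) := by
      have i1 : Integrable (fun g : PSU ι N => ((q n).1 - F) (emb g) * Lap (q n).1 (emb g)) (haarPi ι N) :=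
        integrable_of_continuous_PSU ((continuous_restrict hd).mul (continuous_restrict (contDiff_Lap (hqc n)))) _
      have i2 : Integrable (fun g : PSU ι N => ((q n).1 - F) (emb g) * Lap F (emb g)) (haarPi ι N) :=
        integrable_of_continuous_PSU ((continuous_restrict hd).mul (continuous_restrict (contDiff_Lap hF))) _
      rw [← integral_sub i1 i2]
      refine integral_congr_ae (ae_of_all _ fun g => ?_)
      dsimp only
      rw [Lap_sub_apply (hqc n) hF]
      ring
    -- the first integral vanishes: `x_n - x ⟂ V_n ∋ Δq_n`
    have h3 : ∫ g : PSU ι N, ((q n).1 - F) (emb g) * Lap (q n).1 (emb g) ∂(haarPi ι N) = 0 := by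
      have hLq : sL2 (Lap (q n).1) (contDiff_Lap (hqc n)) ∈ VPoly ι N n :=
        ⟨⟨Lap (q n).1, Lap_mem_polySpace (q n).2⟩, rfl⟩
      have h0 : ⟪x - xn n, sL2 (Lap (q n).1) (contDiff_Lap (hqc n))⟫_ℝ = 0 :=
        Submodule.starProjection_inner_eq_zero x _ hLq
      rw [← hqx n, hx, ← sL2_sub hF (hqc n), inner_sL2_sL2] at h0
      rw [← neg_eq_zero, ← h0, ← integral_neg]
      refine integral_congr_ae (ae_of_all _ fun g => ?_)
      simp only [Pi.sub_apply]
      ring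
    -- the second is bounded by Cauchy–Schwarz
    have h4 : |∫ g : PSU ι N, ((q n).1 - F) (emb g) * Lap F (emb g) ∂(haarPi ι N)| ≤
        ‖xn n - x‖ * ‖sL2 (Lap F) (contDiff_Lap hF)‖ := by
      have hh : ⟪xn n - x, sL2 (Lap F) (contDiff_Lap hF)⟫_ℝ =
          ∫ g : PSU ι N, ((q n).1 - F) (emb g) * Lap F (emb g) ∂(haarPi ι N) := by
        rw [← hqx n, hx, ← sL2_sub (hqc n) hF, inner_sL2_sL2]
      rw [← hh]
      exact abs_real_inner_le_norm _ _
    rw [h1, h2, h3, zero_sub, neg_neg]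
    exact (le_abs_self _).trans h4
  -- conclusion: `J q_n → J F`
  have hlim : Tendsto (fun n => sobJ (q n).1 (hqc n)) atTop (𝓝 (sobJ F hF)) := by
    rw [tendsto_iff_norm_sub_tendsto_zero]
    have hsq : Tendsto (fun n => ‖sobJ (q n).1 (hqc n) - sobJ F hF‖ ^ 2) atTop (𝓝 0) := by
      have hb : ∀ n, ‖sobJ (q n).1 (hqc n) - sobJ F hF‖ ^ 2 ≤
          ‖xn n - x‖ ^ 2 + ‖xn n - x‖ * ‖sL2 (Lap F) (contDiff_Lap hF)‖ := by
        intro n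
        have e1 : ‖xn n - x‖ ^ 2 = ∫ g : PSU ι N, ((q n).1 (emb g) - F (emb g)) ^ 2 ∂(haarPi ι N) := by
          rw [← hqx n, hx, norm_sL2_sub_sL2_sq]
        rw [norm_sobJ_sub_sq (hqc n) hF, ← e1]
        linarith [hE n]
      have h0 : Tendsto (fun n => ‖xn n - x‖ ^ 2 + ‖xn n - x‖ * ‖sL2 (Lap F) (contDiff_Lap hF)‖)
          atTop (𝓝 0) := by
        have := (ht0.pow 2).add (ht0.mul_const ‖sL2 (Lap F) (contDiff_Lap hF)‖)
        simpa using this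
      exact squeeze_zero (fun n => sq_nonneg _) hb h0
    have h1 : Tendsto (fun n => Real.sqrt (‖sobJ (q n).1 (hqc n) - sobJ F hF‖ ^ 2)) atTop (𝓝 (Real.sqrt 0)) :=
      (Real.continuous_sqrt.tendsto 0).comp hsq
    rw [Real.sqrt_zero] at h1
    exact h1.congr fun n => Real.sqrt_sq (norm_nonneg _)
  refine (isClosed_HOne (ι := ι) (N := N)).mem_of_tendsto hlim (Eventually.of_forall fun n => ?_)
  exact sobJ_mem_HOne_of_mem_polySpace (q n).2

end SharpClustering

end Summit.Ventures.YMGap
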